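import Mathlib
import Summits.MatrixMultiplication.MatrixMultiplication.Theses.ThinBlockAlpha
import Summits.MatrixMultiplication.MatrixMultiplication.Theses.GroupTheoreticSTPP
import Summits.MatrixMultiplication.MatrixMultiplication.Theses.DefinableSTPPDichotomy
import Summits.MatrixMultiplication.MatrixMultiplication.Theorems.ThinPackings.Negative.ThinPackingsIffCThesis

/-!
# Line `definable-curved-tiles` — crux `ThinBlockAlpha.ThinPackings` (stmt-MatrixMultiplication-10595)

Crux-strategist line (wall-breaker gen 4, planner-cstrat-stmt-MatrixMultiplication-10595-p4-0, 2026-08-17).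
Card: `Lines/definable-curved-tiles.md`.  Namespace `…Cruxes.ThinPackings.DefinableCurvedTiles`.

THE DOOR.  The gen-4 census (`STRATEGY-CENSUS.md`, gen 4 §F9–F11) classifies the sources of EXACT avoidance an abelian
STPP design can draw on: bounded-exponent coordinates (route item `BoundedThinPackings`, stmt-14848), digits + magnitude
(line `truncated-convolution-designs`, the carry-free Kummer slice = the laser method on `T_ℓ^lower`), digits + carries
(line `cyclic-carry-charts`), non-product free hostings (line `cw2-free-hosting` ⇐ `CwPowerHosting`), SDPP pairs + Behrend
(line `two-families-salem-spencer` ⇐ stmt-0595) — and ONE more, used by no line on this crux: the FIELD structure of `F_p`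
in BOUNDED RANK `m` with `p → ∞` (exponent `p`, unbounded along the family, so Theorem B is silent exactly as for cyclic
hosts), where tiles are CURVED DEFINABLE sets and the cross conditions are OVERDETERMINED algebraic systems (empty for
algebraic reasons, uniformly in `p` — Chatzidakis–van den Dries–Macintyre), the one way to dodge Lang–Weil/Katz
equidistribution, which kills every underdetermined algebraic design (line `log-flat-cyclic-designs`, dead at
`stub_cosetDesign`).  That universe is route `DefinableSTPPDichotomy` (rescuer of the refuted `AlgebraicSTPPDichotomy`;
cones = punctured-subspace frames are barred by `Literature.Barriers.MatrixMultiplication.BoundedRankFrameBarrier`, curved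
tiles are its declared evasion).  Its two OPEN cruxes decide an abelian STPP family in `F^m` beating `|F|^m`:
* `PairwiseCurvedTilingsLC` (stmt-MatrixMultiplication-17883, THE DODGE): ring formulas of fixed complexity realising, in
  finite fields of arbitrarily large characteristic, definable families `(A_x, B_x, C_x)_{x ∈ I(F)} ⊂ F^m` that satisfy
  every STPP pattern with at least two equal labels, at exact mass `|F|^{m+η} ≤ Σ (|A||B||C|)^{(2+ε)/3}`;
* `HexagonClearanceR` (stmt-MatrixMultiplication-17884, THE SEAM, repaired after `…HexagonClearance_refuted`): for small
  `ε` and large characteristic every such family keeps a FULLY STPP sub-family `J ⊆ I` still beating `|F|^m`.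
This file kernel-checks `PairwiseCurvedTilingsLC → HexagonClearanceR → CThesis → ThinPackings` (`cThesis_of`,
`ThinPackings_of`; the last arrow is the landed costume theorem `not_thinPackings_iff_not_cThesis`, p76748), i.e. it draws
the third external edge into stmt-10595 (after stmt-0595 and stmt-15970), and records the by-products
`exactDefinableDesign_implies_cThesis` (the route's target 18073 is at least `X_C`-strong) and
`not_cleared_of_not_cThesis` (a proof of `CAbelianObstructionNeg`, stmt-0596, refutes the conjunction of 17883 and 17884).

WHY IT IS NOT THE DEAD / LIVE LINES.  No digits, no carries, no windows, no charts over a finite alphabet, no hosting of a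
fixed tensor power, no SDPP pairs: the witnesses live in `(ℤ/p)^m` with `m` FIXED and `p → ∞` — the "few coordinates,
growing prime" corner, opposite to every chart/laser line (rank `→ ∞`, alphabet fixed) and outside `BoundedThinPackings`
(no exponent bound serves all `η`).  Closure test (Lines/Ideator4Sketch_dead.md): the heart is not a relaxation or a
symmetrisation-closed restriction of `IsSTPP` families — `HexagonClearanceR` is a universal clearance statement and
`PairwiseCurvedTilingsLC` asks for bounded-complexity definability in bounded rank, which an arbitrary thin family does not
have; `crux → heart` is not claimed, `heart → crux` is proved below.

Disproof used: Disproof.lean (cycles 1–3) has no `_false_without_` theorem; §7 costume theorem USED (composition through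
`CThesis`); §3b honoured (hosts `F^m`, `|F| → ∞`, exponent `p → ∞`; for a FIXED field Theorem B forbids the conclusion,
which is why both cruxes are posed in large characteristic); no landed Negative lemma of this crux concerns definable
bounded-rank families (the relevant negative knowledge is the other route's: `BoundedRankFrameBarrier`,
`DefinableSTPPDichotomyHexagonClearance_refuted`, `AlgebraicSTPPDichotomyExact{Line,Frame}DesignRefutation`).
Negatives index: `HexagonClearance` (stmt-18075, refuted-misstated) is NOT restated — the stub is its repaired successor
stmt-17884 verbatim (by name).
-/

set_option linter.dupNamespace false

namespace Summit.MatrixMultiplication.MatrixMultiplication.Cruxes.ThinPackings.DefinableCurvedTiles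

open Finset
open Summit.MatrixMultiplication.MatrixMultiplication.Theses.ThinBlockAlpha (ThinPackings)
open Summit.MatrixMultiplication.MatrixMultiplication.Theses.GroupTheoreticSTPP (CThesis)
open Summit.MatrixMultiplication.MatrixMultiplication.Theses.DefinableSTPPDichotomy
  (PairwiseCurvedTilingsLC HexagonClearanceR ExactDefinableDesign)

/-! ## Statements of the stubs (by NAME: the other route's decls, never re-worded) -/

namespace Stmt

/-- HEART 1 (external, OPEN): route DefinableSTPPDichotomy's crux `PairwiseCurvedTilingsLC`
(stmt-MatrixMultiplication-17883) — curved definable near-tilings of `F^m`, large characteristic, satisfying every STPP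
pattern with two equal labels, at exact mass. -/
def stub_pairwiseCurvedTilings : Prop := PairwiseCurvedTilingsLC

/-- HEART 2 (external, OPEN): route DefinableSTPPDichotomy's crux `HexagonClearanceR` (stmt-MatrixMultiplication-17884)
— the repaired seam: pairwise-clean exact-mass definable families keep a fully STPP sub-family beating `|F|^m`. -/
def stub_hexagonClearance : Prop := HexagonClearanceR

end Stmt

/-! ## Registered stubs -/

/-- HEART 1 = stmt-MatrixMultiplication-17883 (external). -/
theorem stub_pairwiseCurvedTilings : Stmt.stub_pairwiseCurvedTilings := by
  sorry

/-- HEART 2 = stmt-MatrixMultiplication-17884 (external). -/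
theorem stub_hexagonClearance : Stmt.stub_hexagonClearance := by
  sorry

/-! ## Glue (kernel-checked, no sorry) -/

/-- RE-INDEXING + EXPONENT MONOTONICITY.  An STPP family indexed by a finset `J` of an arbitrary index type in a finite
abelian group `H`, beating `|H|` at exponent `(2+ε')/3`, is a `CThesis` witness (family indexed by `Fin N`) at every
`ε ≥ ε'` (each volume is a natural number: `0 ↦ 0`, and `x ↦ v^x` is monotone for `v ≥ 1`). -/
theorem cThesisWitness_of_finset {ι H : Type} [AddCommGroup H] [Fintype H] (J : Finset ι)
    (A B C : ι → Finset H)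
    (hSTPP : ∀ i ∈ J, ∀ j ∈ J, ∀ k ∈ J, ∀ s ∈ A k, ∀ s' ∈ A i, ∀ t ∈ B i, ∀ t' ∈ B j, ∀ u ∈ C j, ∀ u' ∈ C k,
      (s' - s) + (t' - t) + (u' - u) = 0 → i = j ∧ j = k ∧ s = s' ∧ t = t' ∧ u = u')
    {ε' ε : ℝ} (hε' : 0 < ε') (hle : ε' ≤ ε)
    (hmass : (Fintype.card H : ℝ) <
      ∑ x ∈ J, (((A x).card * (B x).card * (C x).card : ℕ) : ℝ) ^ ((2 + ε') / 3)) :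
    ∃ (N : ℕ) (A' B' C' : Fin N → Finset H),
      (∀ i j k : Fin N, ∀ s ∈ A' k, ∀ s' ∈ A' i, ∀ t ∈ B' i, ∀ t' ∈ B' j, ∀ u ∈ C' j, ∀ u' ∈ C' k,
        (s' - s) + (t' - t) + (u' - u) = 0 → i = j ∧ j = k ∧ s = s' ∧ t = t' ∧ u = u') ∧
      (Fintype.card H : ℝ) < ∑ i, (((A' i).card * (B' i).card * (C' i).card : ℕ) : ℝ) ^ ((2 + ε) / 3) := by
  classical
  set N := J.card with hN
  let e : Fin N → ι := fun i => (J.equivFin.symm i : ι)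
  have hemem : ∀ i, e i ∈ J := fun i => (J.equivFin.symm i).2
  have heinj : Function.Injective e := fun i j hij =>
    J.equivFin.symm.injective (Subtype.ext hij)
  refine ⟨N, fun i => A (e i), fun i => B (e i), fun i => C (e i), ?_, ?_⟩
  · intro i j l s hs s' hs' t ht t' ht' u hu u' hu' hsum
    obtain ⟨hij, hjl, hss, htt, huu⟩ := hSTPP (e i) (hemem i) (e j) (hemem j) (e l) (hemem l)
      s hs s' hs' t ht t' ht' u hu u' hu' hsum
    exact ⟨heinj hij, heinj hjl, hss, htt, huu⟩
  · have hmono : ∑ x ∈ J, (((A x).card * (B x).card * (C x).card : ℕ) : ℝ) ^ ((2 + ε') / 3) ≤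
        ∑ x ∈ J, (((A x).card * (B x).card * (C x).card : ℕ) : ℝ) ^ ((2 + ε) / 3) := by
      refine Finset.sum_le_sum fun x _ => ?_
      rcases Nat.eq_zero_or_pos ((A x).card * (B x).card * (C x).card) with h0 | hpos
      · have h1 : (0 : ℝ) < (2 + ε') / 3 := by linarith
        have h2 : (0 : ℝ) < (2 + ε) / 3 := by linarith
        rw [h0, Nat.cast_zero, Real.zero_rpow h1.ne', Real.zero_rpow h2.ne']
      · exact Real.rpow_le_rpow_of_exponent_le (by exact_mod_cast hpos) (by linarith)
    have hsum : ∑ x ∈ J, (((A x).card * (B x).card * (C x).card : ℕ) : ℝ) ^ ((2 + ε) / 3) =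
        ∑ i : Fin N, (((A (e i)).card * (B (e i)).card * (C (e i)).card : ℕ) : ℝ) ^ ((2 + ε) / 3) := by
      rw [← Finset.sum_coe_sort J]
      exact Fintype.sum_equiv J.equivFin _ _ (fun x => by simp [e])
    calc (Fintype.card H : ℝ)
        < ∑ x ∈ J, (((A x).card * (B x).card * (C x).card : ℕ) : ℝ) ^ ((2 + ε') / 3) := hmass
      _ ≤ ∑ x ∈ J, (((A x).card * (B x).card * (C x).card : ℕ) : ℝ) ^ ((2 + ε) / 3) := hmono
      _ = ∑ i : Fin N, (((A (e i)).card * (B (e i)).card * (C (e i)).card : ℕ) : ℝ) ^ ((2 + ε) / 3) := hsum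

/-- `|F^m| = |F|^m` as a real power (the mass bounds of route DefinableSTPPDichotomy are stated with `rpow`). -/
theorem card_fun_rpow (F : Type) [Fintype F] (m : ℕ) :
    (Fintype.card (Fin m → F) : ℝ) = (Fintype.card F : ℝ) ^ (m : ℝ) := by
  rw [Real.rpow_natCast, Fintype.card_fun, Fintype.card_fin]
  push_cast
  rfl

/-! ## Compositions (kernel-checked, no sorry) -/

/-- THE EDGE: the dodge and the repaired seam of route DefinableSTPPDichotomy give the abelian packing thesis `CThesis`
(stmt-0593) — for every `ε > 0` apply both at `ε' = min ε ε₀(formulas)`, take a field of characteristic `≥ q₁(ε', η)`,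
clear the hexagons, re-index the clean sub-family by `Fin |J|` inside `H = F^m`, and raise the exponent from `ε'` to `ε`. -/
theorem cThesis_of (h₁ : Stmt.stub_pairwiseCurvedTilings) (h₂ : Stmt.stub_hexagonClearance) : CThesis := by
  classical
  intro ε hε
  obtain ⟨e, m, k, φI, φA, φB, φC, hfam⟩ := h₁
  obtain ⟨ε₀, hε₀, hclear⟩ := h₂ e m k φI φA φB φC
  set ε' := min ε ε₀ with hε'def
  have hε' : 0 < ε' := lt_min hε hε₀
  have hε'le : ε' ≤ ε₀ := min_le_right _ _
  have hε'ε : ε' ≤ ε := min_le_left _ _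
  obtain ⟨η, hη, hall⟩ := hfam ε' hε'
  obtain ⟨q₁, hq₁⟩ := hclear ε' η hε' hε'le hη
  obtain ⟨F, instF, instFin, instCR, hq, y, I, A, B, C, hI, hA, hB, hC, hpair, hmass⟩ := hall q₁
  obtain ⟨J, -, hSTPP, hmassJ⟩ := hq₁ F hq y I A B C hI hA hB hC hpair hmass
  have hmassH : (Fintype.card (Fin m → F) : ℝ) <
      ∑ x ∈ J, (((A x).card * (B x).card * (C x).card : ℕ) : ℝ) ^ ((2 + ε') / 3) := by
    rw [card_fun_rpow]; exact hmassJ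
  obtain ⟨N, A', B', C', hS, hM⟩ := cThesisWitness_of_finset J A B C hSTPP hε' hε'ε hmassH
  exact ⟨(Fin m → F), inferInstance, inferInstance, N, A', B', C', hS, hM⟩

/-- The line concludes the crux BY NAME: the two external hearts ⇒ `CThesis` ⇒ `ThinBlockAlpha.ThinPackings` through the
landed costume theorem `not_thinPackings_iff_not_cThesis` (Theorems/ThinPackings/Negative/ThinPackingsIffCThesis.lean,
p76748). -/
theorem ThinPackings_of :
    Stmt.stub_pairwiseCurvedTilings → Stmt.stub_hexagonClearance → ThinPackings := by
  intro h₁ h₂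
  by_contra h
  exact (Summit.MatrixMultiplication.MatrixMultiplication.Theorems.ThinPackings.Negative.not_thinPackings_iff_not_cThesis.mp
    h) (cThesis_of h₁ h₂)

/-- The crux modulo the registered stubs. -/
theorem ThinPackings_proof : ThinPackings := ThinPackings_of stub_pairwiseCurvedTilings stub_hexagonClearance

/-! ## By-products (kernel-checked, no sorry; for routes DefinableSTPPDichotomy and GroupTheoreticSTPP) -/

/-- Route DefinableSTPPDichotomy's TARGET `ExactDefinableDesign` (stmt-18073) is at least `X_C`-strong: it implies the
abelian packing thesis `CThesis` (stmt-0593) by re-indexing alone. -/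
theorem exactDefinableDesign_implies_cThesis (h : ExactDefinableDesign) : CThesis := by
  classical
  intro ε hε
  obtain ⟨e, m, k, φI, φA, φB, φC, hfam⟩ := h
  obtain ⟨F, instF, instFin, instCR, -, y, I, A, B, C, -, -, -, -, hSTPP, hmass⟩ := hfam ε hε 0
  have hmassH : (Fintype.card (Fin m → F) : ℝ) <
      ∑ x ∈ I, (((A x).card * (B x).card * (C x).card : ℕ) : ℝ) ^ ((2 + ε) / 3) := by
    rw [card_fun_rpow]; exact hmass
  obtain ⟨N, A', B', C', hS, hM⟩ := cThesisWitness_of_finset I A B C hSTPP hε le_rfl hmassH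
  exact ⟨(Fin m → F), inferInstance, inferInstance, N, A', B', C', hS, hM⟩

/-- The external edge as one implication, hypotheses under the other route's own names. -/
theorem cleared_implies_cThesis (h₁ : PairwiseCurvedTilingsLC) (h₂ : HexagonClearanceR) : CThesis :=
  cThesis_of h₁ h₂

/-- NEGATION SIDE (for stmt-0596's lane and route DefinableSTPPDichotomy's kill criteria): a proof of the abelian
obstruction `¬ CThesis` (= `CAbelianObstructionNeg`, stmt-0596, up to the landed iff) refutes the conjunction of the two
cruxes 17883 ∧ 17884 — at least one of the dodge / the seam is then false. -/
theorem not_cleared_of_not_cThesis (h : ¬ CThesis) : ¬ (PairwiseCurvedTilingsLC ∧ HexagonClearanceR) :=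
  fun hc => h (cThesis_of hc.1 hc.2)

/-- … and the same for the route's target. -/
theorem not_exactDefinableDesign_of_not_cThesis (h : ¬ CThesis) : ¬ ExactDefinableDesign :=
  fun hd => h (exactDefinableDesign_implies_cThesis hd)

end Summit.MatrixMultiplication.MatrixMultiplication.Cruxes.ThinPackings.DefinableCurvedTiles
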